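import Literature.NumberTheory.EllipticCurves.ComplexMultiplicationCoatesWilesSahProofs
import Literature.NumberTheory.EllipticCurves.PadicPointsFiniteIndexProofs
import Literature.NumberTheory.EllipticCurves.FormalGroupMultiplication
import HarnessLib

/-!
# Coates–Wiles Theorem 11 at a split prime of `ℚ`: the separation input on `E₁(ℚ_p)` and the
# opening of the proof of Lemma 35

Sibling *proofs* file (theorems only: no definition, no named fact, no instance) of
`ComplexMultiplicationCoatesWiles.lean` for the named fact
`Literature.NumberTheory.EllipticCurves.CoatesWiles1977_L_one_div_period_mem_prime`
(J. Coates, A. Wiles, *On the conjecture of Birch and Swinnerton-Dyer*, Invent. Math. **39**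
(1977), §6 p. 250), continuing `ComplexMultiplicationCoatesWilesSahProofs.lean`, which proved the
algebraic skeleton of the Lang–Mazur proof of **Theorem 11** (p. 231):
`CoatesWiles1977.eventually_forall_pow_apply_ne_of_mem_center` — for a group `G` acting on an
additive group `M` (`G = G_∞ = G(Φ_∞/K_𝔭)`, `M = ℰ(Φ_∞)`), a `G`-equivariant `π ∈ End M`
(`π = [ψ(𝔭)]`), Sah's hypothesis and the *separation hypothesis* `⋂ₙ π^{n+1}(M^G) = 0`, no
non-zero fixed `α` is a `π^{n+1}`-th power in `M` for large `n`.

In the fact's setting (`F = ℚ`, `p` split in `K`, `𝔭 = (π)` above `p`) one has `K_𝔭 = ℚ_p`,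
`𝓞_𝔭 = ℤ_p`, and `M^G = ℰ(𝔭) = Ê(pℤ_p)` is the kernel of reduction `E₁(ℚ_p)` of the (globally,
hence `p`-) minimal model (AEC VII.2.2; the tree's `WeierstrassCurve.IsInReductionKernel` with the
parameter `z(P) = -x/y`, `FormalGroup.lean`, `PadicPointsFiltration.lean`). Moreover
`[π][π̄] = [p]` with `π̄ = ψ(𝔭̄)` a `𝔭`-adic unit, so `[π̄]` is an automorphism of the formal
group over `𝓞_𝔭` commuting with `[π]`. This file proves:

* `CoatesWiles1977.eventually_forall_pow_apply_ne_of_addEquiv` — **the split-prime form of the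
  skeleton**: if `u` is a `G`-equivariant additive automorphism of `M` commuting with `π` and
  `π ∘ u = p` (multiplication by the natural number `p` in `M`), then Sah's hypothesis may be put
  on the `p^{n+1}`-torsion (`ker π^{n+1} = M[p^{n+1}]`, `CoatesWiles1977.pow_apply_eq_zero_iff`)
  and the separation hypothesis on `p`-power divisibility in `M^G`
  (`CoatesWiles1977.sep_of_sep_nsmul`: `⋂ₙ p^{n+1} M^G = 0 ⇒ ⋂ₙ π^{n+1}(M^G) = 0`), with the same
  conclusion for `π`;
* `WeierstrassCurve.norm_formalParameter_p_nsmul_le`, `…_p_pow_nsmul_le` — on `E₁(ℚ_p)` of a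
  `p`-integral elliptic `W/ℚ_p`: **`‖z(pP)‖ ≤ p⁻¹‖z(P)‖`**, `‖z(pᵏP)‖ ≤ p⁻ᵏ‖z(P)‖`, i.e.
  `[p] Ê(pⁿℤ_p) ⊆ Ê(pⁿ⁺¹ℤ_p)` (AEC IV.3.2(a) with IV.2.3(a): `[p](T) = pT + O(T²)`; at points,
  from the tree's `‖z(jP) - j z(P)‖ ≤ ‖z(P)‖²`) — the `[p]`-form of the inclusion
  "`[π^{n+1}] ℰ(𝔭) ⊆ ℰ(𝔭^{n+2})`" with which the printed proof of Theorem 11 ends (p. 231, l. −9);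
* `WeierstrassCurve.eq_zero_of_forall_exists_p_pow_nsmul_eq` — hence **the separation
  hypothesis for `[p]` on `E₁(ℚ_p)`**: a point of `E₁(ℚ_p)` divisible by `p^{n+1}` inside
  `E₁(ℚ_p)` for every `n` is `O`; and `WeierstrassCurve.eventually_not_exists_p_pow_nsmul_eq`: a
  non-zero `α ∈ E₁(ℚ_p)` lies in `p^{n+1} E₁(ℚ_p)` for only finitely many `n` (the last sentence
  of the printed proof: "`α` belongs to `[π^{n+1}]ℰ(𝔭)`. But this is impossible for sufficiently
  large `n`, because `α ≠ 0` and `[π^{n+1}]ℰ(𝔭) ⊆ ℰ(𝔭^{n+2})`");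
* `WeierstrassCurve.norm_formalParameter_p_nsmul_eq`, `…_nsmul_eq`,
  `WeierstrassCurve.eq_zero_of_isOfFinAddOrder_of_isInReductionKernel` — for `p` odd the sharp
  form **`‖z(pP)‖ = p⁻¹‖z(P)‖` on all of `E₁(ℚ_p)`** (AEC IV.6.1 at `ℚ_p`, `v(p) = 1 < p - 1`, via
  IV.4.4 `[p](t) = p f(t) + g(t^p)`, the tree's `formalMul_prime_eq_add_subst_X_pow`), hence
  **`‖z(nP)‖ = ‖n‖_p ‖z(P)‖`** and **`E₁(ℚ_p)` is torsion-free** (AEC VII.3.1); in Coates–Wiles'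
  setting (`p > 7` split) this says that `ℰ(𝔭)` has no torsion, in particular no `π`-division
  point of `ℰ` is rational over `K_𝔭` (the source of a `g ∈ G_∞` with `χ(g) ≢ 1 mod 𝔭` for Sah's
  lemma);
* `WeierstrassCurve.exists_pos_forall_nsmul_isInReductionKernel` — **`βE(K_𝔭) ⊆ E₁(K_𝔭)` for
  some integer `β ≥ 1`** (p. 250, proof of Lemma 35: "Let `E₁(K_𝔭)` be the kernel of reduction
  modulo `𝔭` on `E(K_𝔭)`. The index of `E₁(K_𝔭)` in `E(K_𝔭)` is finite because (1) has a good
  reduction modulo `𝔭`. … we can choose `β ≠ 0` in `𝓞` such that `(β, π) = 1` and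
  `βE(K_𝔭) ⊆ E₁(K_𝔭)`"), with `β` the index, finite by the tree's PROVED
  `WeierstrassCurve.finiteIndex_formalFiltration` (AEC VII.6.3); the printed refinement
  `(β, π) = 1` (from "the reduction of the endomorphism `π` of `E` is the Frobenius endomorphism
  of `E` modulo `𝔭`") is not reproduced — it only serves to keep the fields `F_n(Q_n)` unchanged
  when `P` is replaced by `βP`;
* `CoatesWiles1977.exists_nsmul_toPadicPoint` — **the opening of the proof of Lemma 35** (p. 250:
  "Further, `βP` is not the zero element of `E₁(K_𝔭)`, because `P` has infinite order. … we can
  suppose that our point `P` is a non-zero element of `E₁(K_𝔭)`"): for a `ℤ`-integral elliptic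
  `W/ℚ`, a prime `p` and `P ∈ E(ℚ)` of infinite order, some `β ≥ 1` has `α = β·ι(P) ∈ E₁(ℚ_p)`,
  `α ≠ 0`, `α` of infinite order (`ι : E(ℚ) → E(ℚ_p)` the tree's `WeierstrassCurve.toPadicPoint`,
  injective).

What is still missing for Theorem 11 itself at a split prime (and is not formalised anywhere in
the tree): the tower `Φ_∞ = K_𝔭(ℰ_{π^∞})` with `M = ℰ(Φ_∞)` as a `G_∞`-module, the CM
automorphism `u = [π̄]` of `M`, and a central `g ∈ G_∞` with `χ(g) - 1 ∈ ℤ_p^×` (Lubin–Tate theory,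
CW Lemmas 5–7); given these, `eventually_forall_pow_apply_ne_of_addEquiv` applies with the
separation hypothesis discharged by `eq_zero_of_forall_exists_p_pow_nsmul_eq` (as `M^{G_∞} =
E₁(ℚ_p)`), and Sah's hypothesis by `CoatesWiles1977.bijective_smul_sub_of_smul_eq_smul`.

## References

* J. Coates, A. Wiles, *On the conjecture of Birch and Swinnerton-Dyer*, Invent. Math. 39 (1977),
  223–251: §3 p. 231 (Theorem 11 and its proof), §6 p. 250 (proof of Lemma 35). [CoatesWiles1977]
* J. H. Silverman, *The Arithmetic of Elliptic Curves*, 2nd ed., GTM 106 (2009): IV.2.3(a),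
  IV.3.2(a), IV.4.4, IV.6.1, VII.2.2, VII.3.1, VII.6.3. [SilvermanAEC2009]

## Design notes

* Pure proofs file: no `def`, no named fact; net debt delta `0`.
* The abstract part extends `namespace Literature.NumberTheory.EllipticCurves.CoatesWiles1977` of
  the Sah file; the `ℚ_p` part consists of dot-notation theorems on Mathlib's `WeierstrassCurve`,
  in the setting and with the hypotheses of `PadicPointsFiltrationProofs.lean`
  (`[Fact p.Prime] [W.IsIntegral ℤ_[p]] [W.IsElliptic]`).
* `[π̄]` is abstracted as an additive equivalence `u` with `π (u x) = u (π x)` and `π (u x) = p • x`;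
  nothing about formal groups is assumed in the abstract part.
-/

noncomputable section

open scoped Classical

namespace Literature.NumberTheory.EllipticCurves

namespace CoatesWiles1977

/-! ### Split primes: `π ∘ u = p` with `u` an equivariant automorphism commuting with `π` -/

section Split

variable {G M : Type*} [Group G] [AddCommGroup M] [DistribMulAction G M]

/-- `π^n ∘ v^n = p^n` when `π ∘ v = p` and `π`, `v` commute (`[π^n][π̄^n] = [p^n]`). [folklore] -/
theorem pow_apply_pow_apply_eq_nsmul (π v : AddMonoid.End M) (hc : Commute π v) {p : ℕ}
    (hpv : π * v = (p : AddMonoid.End M)) (n : ℕ) (x : M) :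
    (π ^ n) ((v ^ n) x) = p ^ n • x := by
  show (π ^ n * v ^ n) x = p ^ n • x
  rw [← hc.mul_pow, hpv, ← Nat.cast_pow, AddMonoid.End.natCast_apply]

/-- `ker π^n = M[p^n]` when `π ∘ v = p` with `v` invertible and commuting with `π`
(Coates–Wiles: `ℰ_{π^{n+1}} = ℰ_{p^{n+1}}` on the formal group at a split prime, `[π̄]` being an
automorphism of `ℰ`). [folklore] -/
theorem pow_apply_eq_zero_iff (π v w : AddMonoid.End M) (hc : Commute π v) {p : ℕ}
    (hpv : π * v = (p : AddMonoid.End M)) (hvw : v * w = 1) (hwv : w * v = 1) (n : ℕ) (x : M) :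
    (π ^ n) x = 0 ↔ p ^ n • x = 0 := by
  have hcvw : Commute w v := hwv.trans hvw.symm
  have hinv : w ^ n * v ^ n = 1 := by rw [← hcvw.mul_pow, hwv, one_pow]
  have key : p ^ n • x = (v ^ n) ((π ^ n) x) := by
    rw [← pow_apply_pow_apply_eq_nsmul π v hc hpv n x]
    show (π ^ n * v ^ n) x = (v ^ n * π ^ n) x
    rw [(hc.pow_pow n n).eq]
  rw [key]
  constructor
  · intro h
    rw [h, map_zero]
  · intro h
    have : (w ^ n * v ^ n) ((π ^ n) x) = 0 := by
      show (w ^ n) ((v ^ n) ((π ^ n) x)) = 0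
      rw [h, map_zero]
    rwa [hinv, AddMonoid.End.one_apply] at this

/-- **Separation transfers from `p` to `π`.** If `π ∘ v = p` with `v` invertible (inverse `w`,
`G`-equivariant) and commuting with `π`, and no non-zero element of `M^G` is divisible by every
`p^{n+1}` inside `M^G`, then no non-zero element of `M^G` is divisible by every `π^{n+1}` inside
`M^G`: from `π^{n+1} γ = β` with `γ` fixed, `p^{n+1} (w^{n+1} γ) = π^{n+1} v^{n+1} w^{n+1} γ = β`
with `w^{n+1} γ` fixed. (Coates–Wiles p. 231: `[π^{n+1}] ℰ(𝔭) ⊆ ℰ(𝔭^{n+2})`, read through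
`[π̄] ∈ Aut ℰ`.) [cite: CoatesWiles1977, §3 p. 231 (proof of Thm. 11)] -/
theorem sep_of_sep_nsmul (π v w : AddMonoid.End M) (hw : ∀ (σ : G) (x : M), w (σ • x) = σ • w x)
    (hc : Commute π v) {p : ℕ} (hpv : π * v = (p : AddMonoid.End M)) (hvw : v * w = 1)
    (hwv : w * v = 1)
    (hsep : ∀ β : M, (∀ n : ℕ, ∃ γ : M, (∀ σ : G, σ • γ = γ) ∧ p ^ (n + 1) • γ = β) → β = 0)
    (β : M) (hβ : ∀ n : ℕ, ∃ γ : M, (∀ σ : G, σ • γ = γ) ∧ (π ^ (n + 1)) γ = β) : β = 0 := by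
  have hcvw : Commute v w := hvw.trans hwv.symm
  refine hsep β fun n => ?_
  obtain ⟨γ, hγ, hγβ⟩ := hβ n
  refine ⟨(w ^ (n + 1)) γ, fun σ => by rw [← pow_apply_smul w hw, hγ], ?_⟩
  rw [← pow_apply_pow_apply_eq_nsmul π v hc hpv (n + 1)]
  have h1 : (v ^ (n + 1)) ((w ^ (n + 1)) γ) = γ := by
    show (v ^ (n + 1) * w ^ (n + 1)) γ = γ
    rw [← hcvw.mul_pow, hvw, one_pow, AddMonoid.End.one_apply]
  rw [h1, hγβ]

/-- **Coates–Wiles, Theorem 11 — the skeleton at a split prime.** Let `G` act on `M`, let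
`π ∈ End M` be `G`-equivariant, and let `v ∈ End M` be `G`-equivariant, invertible (inverse `w`),
commuting with `π`, with `π ∘ v = p` (in CW, §3 with `F = ℚ` and `p = 𝔭𝔭̄` split: `M = ℰ(Φ_∞)`,
`π = [ψ(𝔭)]`, `v = [ψ(𝔭̄)]`, `[ψ(𝔭)][ψ(𝔭̄)] = [p]`). Assume (Sah) some `g ∈ Z(G)` has
`x ↦ g • x − x` bijective on `M[p^{n+1}]` for every `n`, and (separation) no non-zero element of
`M^G` is divisible by every `p^{n+1}` inside `M^G`. Then for every fixed `α ≠ 0` there is `N` with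
`π^{n+1} y ≠ α` for all `n ≥ N` and all `y ∈ M` — by
`eventually_forall_pow_apply_ne_of_mem_center` with `ker π^{n+1} = M[p^{n+1}]`
(`pow_apply_eq_zero_iff`) and `sep_of_sep_nsmul`.
[cite: CoatesWiles1977, §3 p. 231 (Thm. 11 and its proof)] -/
theorem eventually_forall_pow_apply_ne_of_mul_eq_natCast (π v w : AddMonoid.End M)
    (hπ : ∀ (σ : G) (x : M), π (σ • x) = σ • π x) (hw : ∀ (σ : G) (x : M), w (σ • x) = σ • w x)
    (hc : Commute π v) {p : ℕ} (hpv : π * v = (p : AddMonoid.End M)) (hvw : v * w = 1)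
    (hwv : w * v = 1) {g : G} (hg : g ∈ Subgroup.center G)
    (hbij : ∀ n : ℕ, Set.BijOn (fun x : M => g • x - x)
      {x | p ^ (n + 1) • x = 0} {x | p ^ (n + 1) • x = 0})
    (hsep : ∀ β : M, (∀ n : ℕ, ∃ γ : M, (∀ σ : G, σ • γ = γ) ∧ p ^ (n + 1) • γ = β) → β = 0)
    {α : M} (hα : ∀ σ : G, σ • α = α) (hα0 : α ≠ 0) :
    ∃ N : ℕ, ∀ n : ℕ, N ≤ n → ∀ y : M, (π ^ (n + 1)) y ≠ α := by
  refine eventually_forall_pow_apply_ne_of_mem_center π hπ hg (fun n => ?_)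
    (sep_of_sep_nsmul π v w hw hc hpv hvw hwv hsep) hα hα0
  have hs : {x : M | (π ^ (n + 1)) x = 0} = {x : M | p ^ (n + 1) • x = 0} :=
    Set.ext fun x => pow_apply_eq_zero_iff π v w hc hpv hvw hwv (n + 1) x
  rw [hs]
  exact hbij n

/-- **Coates–Wiles, Theorem 11 — the skeleton at a split prime**, with `[π̄]` an additive
equivalence `u` of `M`: `G`-equivariant, commuting with `π`, `π (u x) = p • x`. See
`eventually_forall_pow_apply_ne_of_mul_eq_natCast`.
[cite: CoatesWiles1977, §3 p. 231 (Thm. 11 and its proof)] -/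
theorem eventually_forall_pow_apply_ne_of_addEquiv (π : AddMonoid.End M) (u : M ≃+ M)
    (hπ : ∀ (σ : G) (x : M), π (σ • x) = σ • π x) (hu : ∀ (σ : G) (x : M), u (σ • x) = σ • u x)
    (hc : ∀ x : M, π (u x) = u (π x)) {p : ℕ} (hp : ∀ x : M, π (u x) = p • x)
    {g : G} (hg : g ∈ Subgroup.center G)
    (hbij : ∀ n : ℕ, Set.BijOn (fun x : M => g • x - x)
      {x | p ^ (n + 1) • x = 0} {x | p ^ (n + 1) • x = 0})
    (hsep : ∀ β : M, (∀ n : ℕ, ∃ γ : M, (∀ σ : G, σ • γ = γ) ∧ p ^ (n + 1) • γ = β) → β = 0)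
    {α : M} (hα : ∀ σ : G, σ • α = α) (hα0 : α ≠ 0) :
    ∃ N : ℕ, ∀ n : ℕ, N ≤ n → ∀ y : M, (π ^ (n + 1)) y ≠ α := by
  set v : AddMonoid.End M := u.toAddMonoidHom with hv
  set w : AddMonoid.End M := u.symm.toAddMonoidHom with hw'
  have hvw : v * w = 1 := AddMonoidHom.ext fun x => u.apply_symm_apply x
  have hwv : w * v = 1 := AddMonoidHom.ext fun x => u.symm_apply_apply x
  have hcomm : Commute π v := AddMonoidHom.ext fun x => hc x
  have hpv : π * v = (p : AddMonoid.End M) :=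
    AddMonoidHom.ext fun x => (hp x).trans (AddMonoid.End.natCast_apply p x).symm
  have hw : ∀ (σ : G) (x : M), w (σ • x) = σ • w x := fun σ x => u.injective <| by
    show u (u.symm (σ • x)) = u (σ • u.symm x)
    rw [u.apply_symm_apply, hu, u.apply_symm_apply]
  exact eventually_forall_pow_apply_ne_of_mul_eq_natCast π v w hπ hw hcomm hpv hvw hwv hg hbij
    hsep hα hα0

end Split

end CoatesWiles1977

end Literature.NumberTheory.EllipticCurves

/-! ### `[p]` raises the level on `E₁(ℚ_p)`; separation for `[p]`; the finite index -/

namespace WeierstrassCurve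

open Literature.NumberTheory.EllipticCurves

section Padic

variable {p : ℕ} [Fact p.Prime] (W : WeierstrassCurve ℚ_[p]) [hW : W.IsIntegral ℤ_[p]]

/-- On `E₁(ℚ_p)` the parameter lies in `pℤ_p`: `‖z(P)‖ ≤ p⁻¹` (`‖z(P)‖ < 1` and `‖ℚ_p^×‖ = p^ℤ`).
[Silverman AEC VII.2.2] [folklore] -/
theorem norm_formalParameter_le_inv {P : W.toAffine.Point} (hP : W.IsInReductionKernel P) :
    ‖W.formalParameter P‖ ≤ (p : ℝ)⁻¹ := by
  have h := W.norm_formalParameter_lt_one hP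
  have h' := (Padic.norm_le_pow_iff_norm_lt_pow_add_one (W.formalParameter P) (-1)).2
    (by rw [neg_add_cancel, zpow_zero]; exact h)
  rwa [zpow_neg_one] at h'

variable [W.IsElliptic]

/-- **`[p]` raises the level by one**: `‖z(pP)‖ ≤ p⁻¹ ‖z(P)‖` for `P ∈ E₁(ℚ_p)`, i.e.
`[p] Ê(pⁿℤ_p) ⊆ Ê(pⁿ⁺¹ℤ_p)` (from `‖z(pP) - p z(P)‖ ≤ ‖z(P)‖² ≤ p⁻¹‖z(P)‖` and
`‖p z(P)‖ = p⁻¹‖z(P)‖`). The `[p]`-form of Coates–Wiles' "`[π^{n+1}] ℰ(𝔭) ⊆ ℰ(𝔭^{n+2})`" at a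
split prime. [Silverman AEC IV.2.3(a), IV.3.2(a), VII.2.2]
[cite: CoatesWiles1977, §3 p. 231 (proof of Thm. 11, last sentence)] -/
theorem norm_formalParameter_p_nsmul_le {P : W.toAffine.Point} (hP : W.IsInReductionKernel P) :
    ‖W.formalParameter (p • P)‖ ≤ (p : ℝ)⁻¹ * ‖W.formalParameter P‖ := by
  have h1 := W.norm_formalParameter_nsmul_sub_le hP p
  have hz := W.norm_formalParameter_le_inv hP
  have hpz : ‖(p : ℚ_[p]) * W.formalParameter P‖ = (p : ℝ)⁻¹ * ‖W.formalParameter P‖ := by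
    rw [norm_mul, Padic.norm_p]
  have hsq : ‖W.formalParameter P‖ ^ 2 ≤ (p : ℝ)⁻¹ * ‖W.formalParameter P‖ := by
    rw [pow_two]
    exact mul_le_mul_of_nonneg_right hz (norm_nonneg _)
  calc ‖W.formalParameter (p • P)‖
      = ‖(W.formalParameter (p • P) - p * W.formalParameter P) + p * W.formalParameter P‖ := by
        rw [sub_add_cancel]
    _ ≤ max ‖W.formalParameter (p • P) - p * W.formalParameter P‖
          ‖(p : ℚ_[p]) * W.formalParameter P‖ := Padic.nonarchimedean _ _
    _ ≤ (p : ℝ)⁻¹ * ‖W.formalParameter P‖ := max_le (h1.trans hsq) hpz.le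

/-- Iterating: `‖z(pᵏP)‖ ≤ p⁻ᵏ ‖z(P)‖` on `E₁(ℚ_p)`, i.e. `[pᵏ] E₁(ℚ_p) ⊆ Ê(pᵏ⁺¹ℤ_p)`.
[Silverman AEC IV.3.2(a), VII.2.2] [cite: CoatesWiles1977, §3 p. 231 (proof of Thm. 11)] -/
theorem norm_formalParameter_p_pow_nsmul_le {P : W.toAffine.Point} (hP : W.IsInReductionKernel P)
    (k : ℕ) :
    ‖W.formalParameter (p ^ k • P)‖ ≤ ((p : ℝ)⁻¹) ^ k * ‖W.formalParameter P‖ := by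
  induction k with
  | zero => rw [pow_zero, one_nsmul, pow_zero, one_mul]
  | succ k ih =>
    have hpk := W.isInReductionKernel_nsmul hP (p ^ k)
    have hp0 : (0 : ℝ) ≤ (p : ℝ)⁻¹ := inv_nonneg.mpr (Nat.cast_nonneg p)
    rw [pow_succ, mul_nsmul]
    calc ‖W.formalParameter (p • p ^ k • P)‖
        ≤ (p : ℝ)⁻¹ * ‖W.formalParameter (p ^ k • P)‖ := W.norm_formalParameter_p_nsmul_le hpk
      _ ≤ (p : ℝ)⁻¹ * (((p : ℝ)⁻¹) ^ k * ‖W.formalParameter P‖) :=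
          mul_le_mul_of_nonneg_left ih hp0
      _ = ((p : ℝ)⁻¹) ^ (k + 1) * ‖W.formalParameter P‖ := by rw [pow_succ]; ring

/-- **Separation for `[p]` on `E₁(ℚ_p)`** (`⋂ₙ pⁿ E₁(ℚ_p) = O`): a point of `E₁(ℚ_p)` which is
divisible by `p^{n+1}` *inside `E₁(ℚ_p)`* for every `n` has parameter of norm `≤ p^{-(n+1)}` for
every `n`, hence is `O`. This is the separation hypothesis `hsep` of
`CoatesWiles1977.eventually_forall_pow_apply_ne_of_mul_eq_natCast` for `M^G = ℰ(𝔭) = E₁(ℚ_p)`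
(`K_𝔭 = ℚ_p` at a split prime). [Silverman AEC IV.3.2(a), VII.2.2]
[cite: CoatesWiles1977, §3 p. 231 (proof of Thm. 11: `[π^{n+1}]ℰ(𝔭) ⊆ ℰ(𝔭^{n+2})`)] -/
theorem eq_zero_of_forall_exists_p_pow_nsmul_eq {β : W.toAffine.Point}
    (hβ : W.IsInReductionKernel β)
    (h : ∀ n : ℕ, ∃ γ : W.toAffine.Point, W.IsInReductionKernel γ ∧ p ^ (n + 1) • γ = β) :
    β = 0 := by
  refine (W.formalParameter_eq_zero_iff hβ).1 (padic_eq_zero_of_norm_le_p_pow fun n hn => ?_)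
  obtain ⟨γ, hγ, hγβ⟩ := h (n - 1)
  rw [Nat.sub_add_cancel hn] at hγβ
  rw [← hγβ]
  have hp0 : (0 : ℝ) ≤ (p : ℝ)⁻¹ := inv_nonneg.mpr (Nat.cast_nonneg p)
  calc ‖W.formalParameter (p ^ n • γ)‖ ≤ ((p : ℝ)⁻¹) ^ n * ‖W.formalParameter γ‖ :=
        W.norm_formalParameter_p_pow_nsmul_le hγ n
    _ ≤ ((p : ℝ)⁻¹) ^ n * 1 :=
        mul_le_mul_of_nonneg_left (W.norm_formalParameter_lt_one hγ).le (pow_nonneg hp0 n)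
    _ = ((p : ℝ)⁻¹) ^ n := mul_one _

/-- **A non-zero `α ∈ E₁(ℚ_p)` lies in `p^{n+1} E₁(ℚ_p)` for only finitely many `n`** — the last
sentence of the Lang–Mazur proof of Theorem 11 ("`α` belongs to `[π^{n+1}]ℰ(𝔭)`. But this is
impossible for sufficiently large `n`, because `α ≠ 0` and `[π^{n+1}]ℰ(𝔭) ⊆ ℰ(𝔭^{n+2})`"), in
`[p]`-form at a split prime. [cite: CoatesWiles1977, §3 p. 231 (proof of Thm. 11, last sentence)] -/
theorem eventually_not_exists_p_pow_nsmul_eq {α : W.toAffine.Point} (hα : W.IsInReductionKernel α)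
    (hα0 : α ≠ 0) :
    ∃ N : ℕ, ∀ n : ℕ, N ≤ n →
      ¬ ∃ γ : W.toAffine.Point, W.IsInReductionKernel γ ∧ p ^ (n + 1) • γ = α := by
  by_contra hN
  push Not at hN
  refine hα0 (W.eq_zero_of_forall_exists_p_pow_nsmul_eq hα fun n => ?_)
  obtain ⟨m, hnm, γ, hγ, hγα⟩ := hN n
  refine ⟨p ^ (m - n) • γ, W.isInReductionKernel_nsmul hγ _, ?_⟩
  rw [← mul_nsmul', ← pow_add, show n + 1 + (m - n) = m + 1 by omega, hγα]

/-- **`βE(K_𝔭) ⊆ E₁(K_𝔭)` for some integer `β ≥ 1`** (Coates–Wiles p. 250, proof of Lemma 35: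
"The index of `E₁(K_𝔭)` in `E(K_𝔭)` is finite because (1) has a good reduction modulo `𝔭` … we
can choose `β ≠ 0` in `𝓞` such that … `βE(K_𝔭) ⊆ E₁(K_𝔭)`"), for `K_𝔭 = ℚ_p`: `β` = the index of
`E₁(ℚ_p)` in `E(ℚ_p)`, finite by the tree's `finiteIndex_formalFiltration` (AEC VII.6.3; any
`p`-integral equation). The printed coprimality `(β, π) = 1` is not reproduced.
[Silverman AEC VII.6.3, VII.2.2] [cite: CoatesWiles1977, §6 p. 250 (proof of Lemma 35)] -/
theorem exists_pos_forall_nsmul_isInReductionKernel :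
    ∃ β : ℕ, 0 < β ∧ ∀ P : W.toAffine.Point, W.IsInReductionKernel (β • P) := by
  haveI := W.finiteIndex_formalFiltration 0
  refine ⟨(W.formalFiltration 0).index, Nat.pos_of_ne_zero AddSubgroup.FiniteIndex.index_ne_zero,
    fun P => ?_⟩
  exact W.mem_formalFiltration_zero_iff.1 ((W.formalFiltration 0).nsmul_index_mem P)

/-! ### `p` odd: `‖z(nP)‖ = ‖n‖_p ‖z(P)‖` on `E₁(ℚ_p)` (AEC IV.6.1 at `ℚ_p`); `E₁(ℚ_p)` is torsion-free -/

omit hW [W.IsElliptic] in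
/-- An integral series without terms of degree `< 2` satisfies `‖f(t)‖ ≤ ‖t‖²` on the open unit
disc. [folklore] -/
theorem _root_.Literature.NumberTheory.EllipticCurves.norm_padicEval_le_sq {f : PowerSeries ℚ_[p]}
    (hf : IsPadicInt f) (h0 : PowerSeries.constantCoeff f = 0) (h1 : PowerSeries.coeff 1 f = 0)
    {t : ℚ_[p]} (ht : ‖t‖ < 1) : ‖padicEval f t‖ ≤ ‖t‖ ^ 2 := by
  unfold padicEval
  refine IsUltrametricDist.norm_tsum_le_of_forall_le_of_nonneg (sq_nonneg _) fun n => ?_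
  rcases n with _ | _ | n
  · rw [PowerSeries.coeff_zero_eq_constantCoeff_apply, h0, zero_mul, norm_zero]
    exact sq_nonneg _
  · rw [h1, zero_mul, norm_zero]
    exact sq_nonneg _
  · rw [norm_mul, norm_pow]
    have hle : ‖t‖ ^ (n + 1 + 1) ≤ ‖t‖ ^ 2 :=
      pow_le_pow_of_le_one (norm_nonneg _) ht.le (by omega)
    calc ‖PowerSeries.coeff (n + 1 + 1) f‖ * ‖t‖ ^ (n + 1 + 1) ≤ 1 * ‖t‖ ^ (n + 1 + 1) :=
          mul_le_mul_of_nonneg_right (isPadicInt_iff_coeff.mp hf _) (pow_nonneg (norm_nonneg _) _)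
      _ ≤ ‖t‖ ^ 2 := by rw [one_mul]; exact hle

omit [W.IsElliptic] in
/-- **`‖z(pP)‖ = p⁻¹ ‖z(P)‖` on all of `E₁(ℚ_p)` for `p` odd** (AEC IV.6.1 with `v(p) = 1 < p - 1`,
through IV.4.4): writing `[p](t) = p f(t) + g(t^p)` with `f, g ∈ ℤ_p⟦t⟧`, `f(t) = t + O(t²)`,
`g(0) = 0` (the tree's `formalMul_prime_eq_add_subst_X_pow`), at `t = z(P)`, `0 < ‖z‖ ≤ p⁻¹`:
`‖p(f(z) - z)‖ ≤ p⁻¹‖z‖² < p⁻¹‖z‖` and `‖g(z^p)‖ ≤ ‖z‖^p ≤ p^{-(p-1)}‖z‖ < p⁻¹‖z‖` as `p ≥ 3`,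
so `‖z(pP)‖ = ‖[p](z)‖ = ‖pz‖`. (For `‖z‖ < p⁻¹` and any `p` this is the tree's
`norm_formalParameter_p_nsmul`.) [Silverman AEC IV.4.4, IV.6.1, VII.2.2]
[cite: SilvermanAEC2009, IV.6.1] -/
theorem norm_formalParameter_p_nsmul_eq (hp2 : p ≠ 2) {P : W.toAffine.Point}
    (hP : W.IsInReductionKernel P) :
    ‖W.formalParameter (p • P)‖ = (p : ℝ)⁻¹ * ‖W.formalParameter P‖ := by
  have hp : p.Prime := Fact.out
  have hz1 : ‖W.formalParameter P‖ < 1 := W.norm_formalParameter_lt_one hP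
  have hzp : ‖W.formalParameter P‖ ≤ (p : ℝ)⁻¹ := W.norm_formalParameter_le_inv hP
  by_cases hz0 : W.formalParameter P = 0
  · have hP0 : P = 0 := (W.formalParameter_eq_zero_iff hP).1 hz0
    rw [hP0, nsmul_zero, W.formalParameter_zero, norm_zero, mul_zero]
  have hzpos : 0 < ‖W.formalParameter P‖ := norm_pos_iff.mpr hz0
  have hp0 : (0 : ℝ) < (p : ℝ)⁻¹ := inv_pos.mpr (by exact_mod_cast hp.pos)
  set z := W.formalParameter P with hzdef
  -- the decomposition `[p] = p f + g(t^p)`, `f = t + h`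
  have hf : IsPadicInt W.formalMulPRemPart := W.isPadicInt_formalMulPRemPart
  have hg : IsPadicInt W.formalMulPDivPart := W.isPadicInt_formalMulPDivPart
  have hh : IsPadicInt (W.formalMulPRemPart - PowerSeries.X) := hf.sub IsPadicInt.powerSeries_X
  have hf0 : PowerSeries.constantCoeff W.formalMulPRemPart = 0 := by
    rw [formalMulPRemPart, ← PowerSeries.coeff_zero_eq_constantCoeff_apply, PowerSeries.coeff_mk,
      if_pos (dvd_zero p)]
  have hf1 : PowerSeries.coeff 1 W.formalMulPRemPart = 1 := by
    have hp1 : ¬ p ∣ 1 := fun h => hp.one_lt.ne' (Nat.dvd_one.mp h)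
    rw [formalMulPRemPart, PowerSeries.coeff_mk, if_neg hp1, W.coeff_one_formalMul,
      inv_mul_cancel₀ (Nat.cast_ne_zero.mpr hp.ne_zero)]
  have hh0 : PowerSeries.constantCoeff (W.formalMulPRemPart - PowerSeries.X) = 0 := by
    rw [map_sub, hf0, PowerSeries.constantCoeff_X, sub_zero]
  have hh1 : PowerSeries.coeff 1 (W.formalMulPRemPart - PowerSeries.X) = 0 := by
    rw [map_sub, hf1, PowerSeries.coeff_one_X, sub_self]
  have hXp : IsPadicInt ((PowerSeries.X : PowerSeries ℚ_[p]) ^ p) := IsPadicInt.powerSeries_X.pow p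
  have hXp0 : PowerSeries.constantCoeff ((PowerSeries.X : PowerSeries ℚ_[p]) ^ p) = 0 := by
    rw [map_pow, PowerSeries.constantCoeff_X, zero_pow hp.ne_zero]
  have hCp : IsPadicInt (PowerSeries.C (p : ℚ_[p])) :=
    IsPadicInt.C (by simpa using Padic.norm_int_le_one (p := p) (p : ℤ))
  have hgs : IsPadicInt (W.formalMulPDivPart.subst ((PowerSeries.X : PowerSeries ℚ_[p]) ^ p)) :=
    hg.powerSeries_subst hXp (PowerSeries.HasSubst.X_pow hp.ne_zero)
  have hfX : W.formalMulPRemPart = PowerSeries.X + (W.formalMulPRemPart - PowerSeries.X) := by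
    ring
  have heval : W.formalParameter (p • P) =
      (p : ℚ_[p]) * z + ((p : ℚ_[p]) * padicEval (W.formalMulPRemPart - PowerSeries.X) z +
        padicEval W.formalMulPDivPart (z ^ p)) := by
    rw [← W.padicEval_formalMul_formalParameter p hP, W.formalMul_prime_eq_add_subst_X_pow,
      padicEval_add (hCp.mul hf) hgs hz1, padicEval_mul hCp hf hz1, padicEval_C,
      padicEval_subst hg hXp hXp0 hz1, padicEval_pow IsPadicInt.powerSeries_X hz1, padicEval_X]
    conv_lhs => rw [hfX, padicEval_add IsPadicInt.powerSeries_X hh hz1, padicEval_X]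
    ring
  -- norms
  have hpz : ‖(p : ℚ_[p]) * z‖ = (p : ℝ)⁻¹ * ‖z‖ := by rw [norm_mul, Padic.norm_p]
  have hsmall : ‖(p : ℚ_[p]) * padicEval (W.formalMulPRemPart - PowerSeries.X) z +
      padicEval W.formalMulPDivPart (z ^ p)‖ < (p : ℝ)⁻¹ * ‖z‖ := by
    refine (Padic.nonarchimedean _ _).trans_lt (max_lt ?_ ?_)
    · rw [norm_mul, Padic.norm_p]
      refine mul_lt_mul_of_pos_left ?_ hp0
      calc ‖padicEval (W.formalMulPRemPart - PowerSeries.X) z‖ ≤ ‖z‖ ^ 2 :=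
            norm_padicEval_le_sq hh hh0 hh1 hz1
        _ < ‖z‖ := by
            rw [pow_two]
            exact mul_lt_of_lt_one_left hzpos hz1
    · have hzp1 : ‖z ^ p‖ < 1 := by
        rw [norm_pow]; exact pow_lt_one₀ (norm_nonneg _) hz1 hp.ne_zero
      have hp3 : 3 ≤ p := by
        rcases hp.eq_two_or_odd' with h | h
        · exact absurd h hp2
        · exact Nat.succ_le_of_lt (lt_of_le_of_ne hp.two_le (fun h2 => hp2 h2.symm))
      calc ‖padicEval W.formalMulPDivPart (z ^ p)‖ ≤ ‖z ^ p‖ :=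
            norm_padicEval_le hg W.constantCoeff_formalMulPDivPart hzp1
        _ = ‖z‖ ^ (p - 1) * ‖z‖ := by rw [norm_pow, ← pow_succ, Nat.sub_add_cancel hp.one_le]
        _ ≤ ((p : ℝ)⁻¹) ^ (p - 1) * ‖z‖ :=
            mul_le_mul_of_nonneg_right (pow_le_pow_left₀ (norm_nonneg _) hzp _) (norm_nonneg _)
        _ < (p : ℝ)⁻¹ * ‖z‖ := by
            refine mul_lt_mul_of_pos_right ?_ hzpos
            exact pow_lt_self_of_lt_one₀ hp0
              (inv_lt_one_of_one_lt₀ (by exact_mod_cast hp.one_lt)) (by omega)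
  rw [heval, Padic.add_eq_max_of_ne (by rw [hpz]; exact hsmall.ne'), hpz, max_eq_left hsmall.le]

/-- **`‖z(mP)‖ = ‖z(P)‖` for `p ∤ m`** on `E₁(ℚ_p)` (`[m](t) = mt + O(t²)` with `m ∈ ℤ_p^×`; from the
tree's `‖z(mP) - m z(P)‖ ≤ ‖z(P)‖²`). [Silverman AEC IV.2.3(a), IV.3.2(b), VII.2.2] [folklore] -/
theorem norm_formalParameter_nsmul_of_not_dvd {m : ℕ} (hm : ¬ p ∣ m) {P : W.toAffine.Point}
    (hP : W.IsInReductionKernel P) :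
    ‖W.formalParameter (m • P)‖ = ‖W.formalParameter P‖ := by
  have hp : p.Prime := Fact.out
  by_cases hz0 : W.formalParameter P = 0
  · have hP0 : P = 0 := (W.formalParameter_eq_zero_iff hP).1 hz0
    rw [hP0, nsmul_zero]
  have hzpos : 0 < ‖W.formalParameter P‖ := norm_pos_iff.mpr hz0
  have hz1 : ‖W.formalParameter P‖ < 1 := W.norm_formalParameter_lt_one hP
  have h1 := W.norm_formalParameter_nsmul_sub_le hP m
  have hmz : ‖(m : ℚ_[p]) * W.formalParameter P‖ = ‖W.formalParameter P‖ := by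
    rw [norm_mul, Padic.norm_natCast_eq_one_iff.mpr ((Nat.Prime.coprime_iff_not_dvd hp).mpr hm),
      one_mul]
  have hlt : ‖W.formalParameter (m • P) - m * W.formalParameter P‖ <
      ‖(m : ℚ_[p]) * W.formalParameter P‖ := by
    rw [hmz]
    refine h1.trans_lt ?_
    rw [pow_two]
    exact mul_lt_of_lt_one_left hzpos hz1
  have key := Padic.add_eq_max_of_ne hlt.ne
  rwa [sub_add_cancel, max_eq_right hlt.le, hmz] at key

omit [W.IsElliptic] in
/-- Iterating `norm_formalParameter_p_nsmul_eq`: `‖z(pᵏP)‖ = p⁻ᵏ ‖z(P)‖` on `E₁(ℚ_p)`, `p` odd.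
[Silverman AEC IV.6.1] [folklore] -/
theorem norm_formalParameter_p_pow_nsmul_eq (hp2 : p ≠ 2) {P : W.toAffine.Point}
    (hP : W.IsInReductionKernel P) (k : ℕ) :
    ‖W.formalParameter (p ^ k • P)‖ = ((p : ℝ)⁻¹) ^ k * ‖W.formalParameter P‖ := by
  induction k with
  | zero => rw [pow_zero, one_nsmul, pow_zero, one_mul]
  | succ k ih =>
    rw [pow_succ, mul_nsmul, W.norm_formalParameter_p_nsmul_eq hp2 (W.isInReductionKernel_nsmul hP _),
      ih, pow_succ]
    ring

/-- **AEC IV.6.1 / VII.3.1 at `ℚ_p`, `p` odd: `‖z(nP)‖ = ‖n‖_p · ‖z(P)‖`** for every `n` and every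
`P ∈ E₁(ℚ_p)` — the parameter of `E₁(ℚ_p) ≅ Ê(pℤ_p)` is an "isometry up to `‖n‖`" for
multiplication by `n` (write `n = pᵏm`, `p ∤ m`). [Silverman AEC IV.6.1, VII.3.1]
[cite: SilvermanAEC2009, IV.6.1] -/
theorem norm_formalParameter_nsmul_eq (hp2 : p ≠ 2) (n : ℕ) {P : W.toAffine.Point}
    (hP : W.IsInReductionKernel P) :
    ‖W.formalParameter (n • P)‖ = ‖(n : ℚ_[p])‖ * ‖W.formalParameter P‖ := by
  have hp : p.Prime := Fact.out
  rcases eq_or_ne n 0 with rfl | hn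
  · rw [zero_nsmul, W.formalParameter_zero, norm_zero, Nat.cast_zero, norm_zero, zero_mul]
  obtain ⟨k, m, hm, rfl⟩ := Nat.exists_eq_pow_mul_and_not_dvd hn p hp.one_lt.ne'
  rw [mul_nsmul', W.norm_formalParameter_p_pow_nsmul_eq hp2 (W.isInReductionKernel_nsmul hP m),
    W.norm_formalParameter_nsmul_of_not_dvd hm hP, Nat.cast_mul, norm_mul, Nat.cast_pow, norm_pow,
    Padic.norm_p, Padic.norm_natCast_eq_one_iff.mpr ((Nat.Prime.coprime_iff_not_dvd hp).mpr hm),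
    mul_one]

/-- **`E₁(ℚ_p)` is torsion-free for `p` odd** (AEC IV.6.1 with VII.3.1: no `p`-torsion since
`v(p) = 1 < p - 1`, no prime-to-`p` torsion in the kernel of reduction). In Coates–Wiles (§3,
split `p > 7`): `ℰ(𝔭) = E₁(ℚ_p)` has no torsion, so in particular `ℰ_π ∩ ℰ(𝔭) = 0` — no
`π`-division point of the formal group is rational over `K_𝔭`, which is what produces an element
`g ∈ G_∞` with `χ(g) ≢ 1 (mod 𝔭)` for Sah's lemma. [Silverman AEC IV.6.1, VII.3.1]
[cite: SilvermanAEC2009, IV.6.1] -/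
theorem eq_zero_of_isOfFinAddOrder_of_isInReductionKernel (hp2 : p ≠ 2) {P : W.toAffine.Point}
    (hP : W.IsInReductionKernel P) (hfin : IsOfFinAddOrder P) : P = 0 := by
  obtain ⟨n, hn, hnP⟩ := hfin.exists_nsmul_eq_zero
  have h := W.norm_formalParameter_nsmul_eq hp2 n hP
  rw [hnP, W.formalParameter_zero, norm_zero] at h
  have hn0 : ‖(n : ℚ_[p])‖ ≠ 0 := norm_ne_zero_iff.mpr (Nat.cast_ne_zero.mpr hn.ne')
  exact (W.formalParameter_eq_zero_iff hP).1
    (norm_eq_zero.mp ((mul_eq_zero.mp h.symm).resolve_left hn0))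

/-- Equivalently: for `p` odd, `E₁(ℚ_p)` meets the torsion of `E(ℚ_p)` only in `O`; e.g. no
non-zero `p`-torsion point of `E(ℚ_p)` lies in the kernel of reduction.
[Silverman AEC VII.3.1] [cite: SilvermanAEC2009, VII.3.1] -/
theorem not_isInReductionKernel_of_isOfFinAddOrder (hp2 : p ≠ 2) {P : W.toAffine.Point}
    (hfin : IsOfFinAddOrder P) (hP0 : P ≠ 0) : ¬ W.IsInReductionKernel P := fun hP =>
  hP0 (W.eq_zero_of_isOfFinAddOrder_of_isInReductionKernel hp2 hP hfin)

end Padic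

/-! ### From `E(ℚ)`: the point `α = βP` of the proof of Lemma 35 -/

section Rat

variable (W : WeierstrassCurve ℚ) (p : ℕ) [Fact p.Prime]

/-- A rational point of infinite order has infinite order in `E(ℚ_p)` (`E(ℚ) → E(ℚ_p)` is an
injective homomorphism). [folklore] -/
theorem not_isOfFinAddOrder_toPadicPoint {P : W.toAffine.Point} (hP : ¬ IsOfFinAddOrder P) :
    ¬ IsOfFinAddOrder (W.toPadicPoint p P) := fun h =>
  hP <| (Function.Injective.isOfFinAddOrder_iff (f := W.toPadicPoint p)
    (Affine.Point.map_injective (W' := W.toAffine) (f := Algebra.ofId ℚ ℚ_[p]))).1 h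

end Rat

end WeierstrassCurve

namespace Literature.NumberTheory.EllipticCurves

namespace CoatesWiles1977

/-- **The opening of the proof of Lemma 35** (Coates–Wiles p. 250: "Let `E₁(K_𝔭)` be the kernel
of reduction modulo `𝔭` on `E(K_𝔭)`. The index of `E₁(K_𝔭)` in `E(K_𝔭)` is finite … we can choose
`β ≠ 0` in `𝓞` such that `(β, π) = 1` and `βE(K_𝔭) ⊆ E₁(K_𝔭)`. Further, `βP` is not the zero
element of `E₁(K_𝔭)`, because `P` has infinite order. … we can suppose that our point `P` is a
non-zero element of `E₁(K_𝔭)`"), for `F = ℚ` and `K_𝔭 = ℚ_p`, without the coprimality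
`(β, π) = 1`: for a `ℤ`-integral elliptic `W/ℚ` (e.g. globally minimal), a prime `p` and
`P ∈ E(ℚ)` of infinite order, there is an integer `β ≥ 1` with `α = β · ι(P) ∈ E₁(ℚ_p)` non-zero
and of infinite order (`ι = toPadicPoint`). [cite: CoatesWiles1977, §6 p. 250 (proof of Lemma 35)] -/
theorem exists_nsmul_toPadicPoint (W : WeierstrassCurve ℚ) [W.IsElliptic] [W.IsIntegral ℤ]
    (p : ℕ) [Fact p.Prime] {P : W.toAffine.Point} (hP : ¬ IsOfFinAddOrder P) :
    ∃ β : ℕ, 0 < β ∧ (W.baseChange ℚ_[p]).IsInReductionKernel (β • W.toPadicPoint p P) ∧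
      β • W.toPadicPoint p P ≠ 0 ∧ ¬ IsOfFinAddOrder (β • W.toPadicPoint p P) := by
  obtain ⟨β, hβ, h⟩ := (W.baseChange ℚ_[p]).exists_pos_forall_nsmul_isInReductionKernel
  have hfin : ¬ IsOfFinAddOrder (β • W.toPadicPoint p P) := by
    rw [isOfFinAddOrder_nsmul]
    push Not
    exact ⟨W.not_isOfFinAddOrder_toPadicPoint p hP, hβ.ne'⟩
  refine ⟨β, hβ, h _, fun h0 => hfin ?_, hfin⟩
  rw [h0]
  exact IsOfFinAddOrder.zero

/-- **Lemma 35, the `ℚ_p`-shadow of its conclusion.** With `α = β · ι(P) ∈ E₁(ℚ_p)` as in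
`exists_nsmul_toPadicPoint`, `α ∉ p^{n+1} E₁(ℚ_p)` for all large `n`
(`WeierstrassCurve.eventually_not_exists_p_pow_nsmul_eq`); in Coates–Wiles this is the level-`K_𝔭`
trace of "`H_n F_∞ / F_∞` is non-trivial for all sufficiently large `n`" (the points `Q_n` with
`π^{n+1} Q_n = P` cannot be found inside `ℰ(𝔭)`), the full statement needing the tower `Φ_∞`.
[cite: CoatesWiles1977, §6 p. 250 (Lemma 35) with §3 p. 231 (Thm. 11)] -/
theorem exists_nsmul_toPadicPoint_eventually_not_divisible (W : WeierstrassCurve ℚ) [W.IsElliptic]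
    [W.IsIntegral ℤ] (p : ℕ) [Fact p.Prime] {P : W.toAffine.Point} (hP : ¬ IsOfFinAddOrder P) :
    ∃ β : ℕ, 0 < β ∧ (W.baseChange ℚ_[p]).IsInReductionKernel (β • W.toPadicPoint p P) ∧
      ∃ N : ℕ, ∀ n : ℕ, N ≤ n → ¬ ∃ γ : (W.baseChange ℚ_[p]).toAffine.Point,
        (W.baseChange ℚ_[p]).IsInReductionKernel γ ∧ p ^ (n + 1) • γ = β • W.toPadicPoint p P := by
  obtain ⟨β, hβ, hα, hα0, -⟩ := exists_nsmul_toPadicPoint W p hP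
  exact ⟨β, hβ, hα, (W.baseChange ℚ_[p]).eventually_not_exists_p_pow_nsmul_eq hα hα0⟩

end CoatesWiles1977

end Literature.NumberTheory.EllipticCurves
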